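import Literature.NumberTheory.GaloisRepresentations.KummerUnramifiedUnit
import Literature.NumberTheory.Automorphic.GaloisActionPlaces
import Literature.NumberTheory.Automorphic.IdeleIdealClass
import Mathlib.NumberTheory.RamificationInertia.Unramified
import Mathlib.NumberTheory.RamificationInertia.Valuation
import Mathlib.NumberTheory.NumberField.ClassNumber
import HarnessLib

/-!
# Galois-invariant radical classes in an extension unramified outside `S` descend up to the class number

Topic `NumberTheory/GaloisRepresentations`; namespace `Literature.NumberTheory.GaloisRepresentations`.
Everything in this file is **proved** (no definition, no named fact, D-0026).  It supplies the
arithmetic — class-field-theory-free — input of the statement that the kernel of the inflation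
`H²(G_S(K), μ_{p^m}) → H²(K, μ_{p^m})` (`G_S = Gal(K_S/K)`, `S ⊇ {v ∣ p}`) dies under the change of
coefficients `μ_{p^m} ↪ μ_{p^{m+e}}`, `p^e ∥ #Cl(𝓞_K)` (Neukirch–Schmidt–Wingberg VIII §3, proof of
(8.3.11): the term `Cl_S(K)/p^m`), which in turn is the step "restricted ramification" of Iwasawa's
theorem `H²(G_S(K^{cyc}_∞), ℚ_p/ℤ_p) = 0` (NSW (10.3.25)) on the tree's road to the named fact
`IwasawaTheory.weakLeopoldt_H2_subsingleton_cyclotomic_of_isOpen`.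

* `smul_root_eq_of_mem_inertia_of_dvd` — **Kummer extensions `k(u^{1/d})`, `d ∣ ord_w(u)`, `w ∤ d`,
  are unramified at `w`**, in the inertia-group form of the tree (`KummerUnramifiedUnit`): every
  element of an inertia group above `w` of a Galois `Ω/k` fixes every `d`-th root `α ∈ Ω` of `u`
  (Silverman, *AEC* VIII.1.6, proof; Neukirch, *Bonn Lectures* III (7.7), proof).  The unit case
  `ord_w(u) = 0`, `u ∈ 𝓞_k` is the tree's `smul_root_eq_of_mem_inertia`; the reduction multiplies `α`
  by `π^{-j} δ` for a uniformiser `π` and a `w`-unit denominator `δ` (Mathlib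
  `HeightOneSpectrum.valuation_exists_uniformizer`, `exists_primeCompl_mul_eq_of_integer`).
* `dvd_log_valuation_sub_of_under_eq` — if `τ b ∈ b · (Lˣ)^N` for all `τ ∈ Gal(L/K)`, the
  valuations of `b` at two places of `L` above the same place of `K` are congruent mod `N`
  (transitivity of `Gal(L/K)` on the fibres, tree `GaloisActionPlaces`).
* `exists_dvd_log_valuation_pow_mul_of_galois_invariant` — **descent of the divisor**: if moreover
  `L/K` is unramified outside `S` (Mathlib `Algebra.IsUnramifiedIn`), then with `h = #Cl(𝓞_K)` there
  is `c ∈ Kˣ` with `h·N ∣ ord_w(b^h c)` at every place `w` of `L` above a place outside `S`: the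
  divisor of `b` away from `S` is mod `N` the pull-back (`e = 1`, Mathlib
  `Algebra.IsUnramifiedIn.ramificationIdx_eq_one`, `HeightOneSpectrum.valuation_liesOver`) of a
  fractional ideal `𝔟 = ∏ v^{n_v}` of `K` (Mathlib `FractionalIdeal.count_finprod`), and `𝔟^h` is
  principal (Mathlib `ClassGroup.mk_eq_one_iff`, `pow_card_eq_one`; tree
  `FractionalIdeal.count_spanSingleton_eq_neg_log_valuation`).

Valuations are written as `WithZero.log (w.valuation L x) = -ord_w(x)` (Mathlib's sign), as in the
tree's `KummerUnramified`.  What is NOT here: the passage to the absolute Galois group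
(`N_S = ramificationSubgroup K S`, `b ∈ K̄^{N_S}`; next file) and all cohomology.

## References

* J. Neukirch, A. Schmidt, K. Wingberg, *Cohomology of Number Fields*, 2nd ed. (2008), VIII §3,
  (8.3.11) and its proof; (10.3.25). [NeukirchSchmidtWingberg2008]
* J. H. Silverman, *The Arithmetic of Elliptic Curves*, 2nd ed. (2009), Prop. VIII.1.6 (proof).
  [SilvermanAEC2009]
* J. Neukirch, *Class Field Theory — The Bonn Lectures* (2013), Part III Thm. (7.7) (proof, p. 176).
  [Neukirch2013]
* J. W. S. Cassels, A. Fröhlich (eds.), *Algebraic Number Theory* (1967), Ch. VII Prop. 1.2 (ii).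
  [CasselsFrohlichANT1967]

## Mathlib / tree search

`lean search 'smul_root_eq_of_mem_inertia|valuation_exists_uniformizer|exists_primeCompl_mul_eq_of_integer|count_finprod|count_spanSingleton_eq_neg_log_valuation|exists_algEquiv_smul_eq|valuation_liesOver|IsUnramifiedIn.ramificationIdx_eq_one'`
(all used); `lean search 'of_dvd.*inertia|radical.*descen|invariant.*radical'`: no prior statement of
either result.
-/

noncomputable section

open scoped NumberField nonZeroDivisors
open NumberField IsDedekindDomain IsDedekindDomain.HeightOneSpectrum Field WithZero

universe u

namespace Literature.NumberTheory.GaloisRepresentations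

/-! ### §1. Inertia fixes the `d`-th roots of an element whose valuation is divisible by `d` -/

section KummerDivisible

variable {k : Type u} [Field k] [NumberField k] {Ω : Type u} [Field Ω] [Algebra k Ω]

/-- **Inertia fixes `u^{1/d}` when `d ∣ ord_w(u)` and `w ∤ d`.**  Let `k ∋ ζ` be a number field with
`ζ` a primitive `d`-th root of unity, `Ω/k` Galois, `u ∈ kˣ` with `d ∣ ord_w(u)` at a finite place
`w ∤ d` of `k`, `α ∈ Ω` with `α^d = u`, and `𝔓` a prime of the integral closure of `𝓞_k` in `Ω`
above `w`.  Then every `σ` in the inertia group `I_𝔓 ≤ Gal(Ω/k)` fixes `α` (Silverman, *AEC*,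
proof of Prop. VIII.1.6: "`K_v(a^{1/m})/K_v` is unramified if and only if `ord_v(a) ≡ 0 (mod m)`",
the "if" direction; Neukirch, *Bonn Lectures* III (7.7)).  Reduction to the unit case
`smul_root_eq_of_mem_inertia`: with `π` a uniformiser at `w` and `ord_w(u) = d j`, the element
`u π^{-dj}` is a `w`-unit `n/δ` (`n, δ ∈ 𝓞_k ∖ w`), and `α π^{-j} δ` is a `d`-th root of the
`w`-unit `n δ^{d-1} ∈ 𝓞_k`.
[cite: SilvermanAEC2009, Prop. VIII.1.6 (proof)] [cite: Neukirch2013, Part III Thm. (7.7) (proof, p. 176)] -/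
theorem smul_root_eq_of_mem_inertia_of_dvd {d : ℕ} (hd : 0 < d) {ζ : k} (hζ : IsPrimitiveRoot ζ d)
    {u : k} (hu : u ≠ 0) (w : HeightOneSpectrum (𝓞 k)) (hdw : ((d : ℕ) : 𝓞 k) ∉ w.asIdeal)
    (hdvd : (d : ℤ) ∣ log (w.valuation k u))
    {α : Ω} (hα : α ^ d = algebraMap k Ω u)
    (𝔓 : Ideal (integralClosure (𝓞 k) Ω)) [𝔓.IsPrime] [𝔓.LiesOver w.asIdeal]
    {σ : Ω ≃ₐ[k] Ω} (hσ : σ ∈ 𝔓.inertia (Ω ≃ₐ[k] Ω)) : σ α = α := by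
  classical
  obtain ⟨j, hj⟩ := hdvd
  -- a uniformiser `π` at `w`
  obtain ⟨π, hπ⟩ := w.valuation_exists_uniformizer k
  have hπ0 : π ≠ 0 := by
    intro h
    rw [h, map_zero] at hπ
    exact WithZero.zero_ne_coe hπ
  have hu0' : w.valuation k u ≠ 0 := (Valuation.ne_zero_iff _).2 hu
  -- `u' = u * π ^ (d j)` is a `w`-unit
  set u' : k := u * π ^ (d * j : ℤ) with hu'def
  have hu'0 : u' ≠ 0 := mul_ne_zero hu (zpow_ne_zero _ hπ0)
  have hval : w.valuation k u' = 1 := by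
    have h1 : w.valuation k u' ≠ 0 := (Valuation.ne_zero_iff _).2 hu'0
    rw [← exp_log h1]
    have h2 : log (w.valuation k u') = 0 := by
      rw [hu'def, map_mul, map_zpow₀, log_mul hu0' (zpow_ne_zero _ ((Valuation.ne_zero_iff _).2 hπ0)),
        log_zpow, hπ, log_exp, hj]
      ring
    rw [h2, exp_zero]
  -- write `u' = n / δ` with `n, δ ∈ 𝓞 k ∖ w`
  obtain ⟨n, δ, hnδ⟩ := w.exists_primeCompl_mul_eq_of_integer u' hval.le
  have hδ : (δ : 𝓞 k) ∉ w.asIdeal := δ.2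
  have hδ0 : algebraMap (𝓞 k) k (δ : 𝓞 k) ≠ 0 := fun h =>
    hδ (by rw [(map_eq_zero_iff _ RingOfIntegers.coe_injective).mp h]; exact w.asIdeal.zero_mem)
  have hδ1 : w.valuation k (algebraMap (𝓞 k) k (δ : 𝓞 k)) = 1 :=
    (w.valuation_of_algebraMap (K := k) (δ : 𝓞 k)).trans ((intValuation_eq_one_iff (v := w)).2 hδ)
  have hn1 : w.valuation k (algebraMap (𝓞 k) k n) = 1 := by
    rw [← hnδ, map_mul, hval, one_mul, hδ1]
  have hn : n ∉ w.asIdeal :=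
    (intValuation_eq_one_iff (v := w)).1 ((w.valuation_of_algebraMap (K := k) n).symm.trans hn1)
  -- the `d`-th root `α' = α π^{-j}·δ... = α * π^j * δ` of the `w`-unit `a = n δ^{d-1}`
  set a : 𝓞 k := n * (δ : 𝓞 k) ^ (d - 1) with hadef
  have haw : a ∉ w.asIdeal := by
    intro h
    rcases w.isPrime.mem_or_mem h with h | h
    · exact hn h
    · exact hδ (w.isPrime.mem_of_pow_mem _ h)
  set α' : Ω := α * algebraMap k Ω π ^ (j : ℤ) * algebraMap k Ω (algebraMap (𝓞 k) k (δ : 𝓞 k))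
    with hα'def
  have hd1 : d = d - 1 + 1 := (Nat.sub_add_cancel hd).symm
  have hpow : (algebraMap (𝓞 k) k (δ : 𝓞 k)) ^ d =
      (algebraMap (𝓞 k) k (δ : 𝓞 k)) ^ (d - 1) * algebraMap (𝓞 k) k (δ : 𝓞 k) := by
    conv_lhs => rw [hd1]
    exact pow_succ _ _
  have key : algebraMap (𝓞 k) k a = u * π ^ (d * j : ℤ) * (algebraMap (𝓞 k) k (δ : 𝓞 k)) ^ d := by
    rw [hadef, map_mul, map_pow, ← hnδ, hu'def, hpow]
    ring
  have hα' : α' ^ d = algebraMap (𝓞 k) Ω a := by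
    rw [IsScalarTower.algebraMap_apply (𝓞 k) k Ω, key, hα'def, mul_pow, mul_pow, hα,
      ← zpow_natCast (algebraMap k Ω π ^ (j : ℤ)) d, ← zpow_mul, map_mul, map_mul, map_zpow₀,
      map_pow, mul_comm (j : ℤ) (d : ℤ)]
  have hfix : σ α' = α' := smul_root_eq_of_mem_inertia hd hζ w haw hdw hα' 𝔓 hσ
  -- conclude
  have hc : algebraMap k Ω π ^ (j : ℤ) * algebraMap k Ω (algebraMap (𝓞 k) k (δ : 𝓞 k)) ≠ 0 :=
    mul_ne_zero (zpow_ne_zero _ ((map_ne_zero _).2 hπ0)) ((map_ne_zero _).2 hδ0)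
  rw [hα'def, mul_assoc, map_mul, map_mul, map_zpow₀, AlgEquiv.commutes, AlgEquiv.commutes] at hfix
  exact mul_right_cancel₀ hc hfix

end KummerDivisible

/-! ### §2. Galois-invariant radical classes: the divisor outside `S` descends to `K` -/

section Descent

open Literature.NumberTheory.Automorphic

variable {K : Type u} [Field K] [NumberField K] {L : Type u} [Field L] [NumberField L] [Algebra K L]

/-- **Conjugate places see a Galois-invariant radical class with valuations congruent mod `N`.**
If `τ b = b · γ_τ^N` for every `τ ∈ Gal(L/K)` (`b ∈ Lˣ`, `N ≥ 1`), then for two places `w, w'` of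
`L` above the same place of `K` one has `N ∣ ord_w(b) - ord_{w'}(b)` (the places above a given
place are permuted transitively by `Gal(L/K)`, Cassels–Fröhlich VII Prop. 1.2 (ii), and
`ord_{τ w}(τ b) = ord_w(b)`). [cite: CasselsFrohlichANT1967, Ch. VII Prop. 1.2 (ii)] -/
theorem dvd_log_valuation_sub_of_under_eq [IsGalois K L] {N : ℕ} (hN : 0 < N) {b : L}
    (hb : b ≠ 0) (hγ : ∀ τ : L ≃ₐ[K] L, ∃ γ : L, τ b = b * γ ^ N)
    {w w' : HeightOneSpectrum (𝓞 L)} (hww' : w.under (𝓞 K) = w'.under (𝓞 K)) :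
    (N : ℤ) ∣ log (w.valuation L b) - log (w'.valuation L b) := by
  obtain ⟨σ, hσ⟩ := HeightOneSpectrum.exists_algEquiv_smul_eq K hww'
  obtain ⟨γ, hγσ⟩ := hγ σ
  have hγ0 : γ ≠ 0 := by
    rintro rfl
    rw [zero_pow hN.ne', mul_zero, map_eq_zero_iff _ σ.injective] at hγσ
    exact hb hγσ
  have hval : w'.valuation L (σ b) = w.valuation L b := by
    rw [← hσ]
    exact HeightOneSpectrum.valuation_algEquiv_smul K σ w b
  rw [hγσ, map_mul, map_pow] at hval
  have hb0 : w'.valuation L b ≠ 0 := (Valuation.ne_zero_iff _).2 hb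
  have hγ0' : w'.valuation L γ ≠ 0 := (Valuation.ne_zero_iff _).2 hγ0
  refine ⟨log (w'.valuation L γ), ?_⟩
  rw [← hval, log_mul hb0 (pow_ne_zero _ hγ0'), log_pow]
  ring

/-- The places of `L` at which a given `b ∈ Lˣ` is not a unit form a finite set (there are finitely
many prime factors of the principal fractional ideal `(b)`, Mathlib `FractionalIdeal.finite_factors`).
[folklore] -/
private theorem finite_setOf_log_valuation_ne_zero {b : L} (hb : b ≠ 0) :
    {w : HeightOneSpectrum (𝓞 L) | log (w.valuation L b) ≠ 0}.Finite := by
  have h := FractionalIdeal.finite_factors (FractionalIdeal.spanSingleton (𝓞 L)⁰ b)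
  rw [Filter.eventually_cofinite] at h
  refine h.subset fun w hw => ?_
  rw [Set.mem_setOf_eq] at hw ⊢
  rw [show b = ((Units.mk0 b hb : Lˣ) : L) from rfl,
    FractionalIdeal.count_spanSingleton_eq_neg_log_valuation, neg_eq_zero]
  exact hw

/-- **The divisor of a Galois-invariant radical class descends, up to the class number.**  Let
`L/K` be a Galois extension of number fields which is unramified at every finite place of `K`
outside `S`, let `N ≥ 1` and let `b ∈ Lˣ` satisfy `τ b ∈ b · (Lˣ)^N` for every `τ ∈ Gal(L/K)`
(the class of `b` in `Lˣ/(Lˣ)^N` is `Gal(L/K)`-invariant).  Then, with `h = #Cl(𝓞_K)`, there is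
`c ∈ Kˣ` such that `h·N ∣ ord_w(b^h c)` at EVERY place `w` of `L` above a place of `K` outside `S`.
Proof: by `dvd_log_valuation_sub_of_under_eq` the divisor of `b` away from `S` is, modulo `N`, the
pull-back of a divisor `𝔟 = ∏ v^{n_v}` of `K` (`n_v = ord_{w_v}(b)` for one `w_v ∣ v`; `e(w|v) = 1`
by unramifiedness, Mathlib `Algebra.IsUnramifiedIn.ramificationIdx_eq_one`); `𝔟^h = (c⁻¹)` is
principal (`#Cl(𝓞_K) = h`), and `ord_w(b^h c) = h (ord_w b - ord_{w_v} b)`.  This is the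
element-level content of the exactness of `0 → Cl_S(K)/N → H²(G_S, μ_N)`-type statements
(Neukirch–Schmidt–Wingberg (8.3.11), proof) used to show that the kernel of
`H²(G_S(K), μ_{p^m}) → H²(K, μ_{p^m})` dies under `μ_{p^m} ↪ μ_{p^{m+e}}`, `p^e ∥ h`.
[cite: NeukirchSchmidtWingberg2008, VIII §3 (8.3.11) (proof)] -/
theorem exists_dvd_log_valuation_pow_mul_of_galois_invariant [IsGalois K L]
    (S : Set (HeightOneSpectrum (𝓞 K)))
    (hunr : ∀ v : HeightOneSpectrum (𝓞 K), v ∉ S → Algebra.IsUnramifiedIn (𝓞 L) v.asIdeal)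
    {N : ℕ} (hN : 0 < N) {b : L} (hb : b ≠ 0)
    (hγ : ∀ τ : L ≃ₐ[K] L, ∃ γ : L, τ b = b * γ ^ N) :
    ∃ c : K, c ≠ 0 ∧ ∀ w : HeightOneSpectrum (𝓞 L), w.under (𝓞 K) ∉ S →
      ((Fintype.card (ClassGroup (𝓞 K)) * N : ℕ) : ℤ) ∣
        log (w.valuation L (b ^ Fintype.card (ClassGroup (𝓞 K)) * algebraMap K L c)) := by
  classical
  set h : ℕ := Fintype.card (ClassGroup (𝓞 K)) with hh
  -- the descended exponents `n_v`
  let n : HeightOneSpectrum (𝓞 K) → ℤ := fun v =>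
    if hv : ∃ w : HeightOneSpectrum (𝓞 L), w.under (𝓞 K) = v then
      log ((Classical.choose hv).valuation L b) else 0
  have hn_fin : ∀ᶠ v : HeightOneSpectrum (𝓞 K) in Filter.cofinite, n v = 0 := by
    rw [Filter.eventually_cofinite]
    refine ((finite_setOf_log_valuation_ne_zero hb).image
      (fun w : HeightOneSpectrum (𝓞 L) => w.under (𝓞 K))).subset fun v hv => ?_
    rw [Set.mem_setOf_eq] at hv
    by_cases hex : ∃ w : HeightOneSpectrum (𝓞 L), w.under (𝓞 K) = v
    · simp only [n, dif_pos hex] at hv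
      exact ⟨Classical.choose hex, hv, Classical.choose_spec hex⟩
    · exfalso
      apply hv
      simp only [n, dif_neg hex]
  -- the fractional ideal `𝔟 = ∏ v ^ n_v` of `K` and a generator of `𝔟 ^ h`
  set 𝔟 : FractionalIdeal (𝓞 K)⁰ K :=
    ∏ᶠ v : HeightOneSpectrum (𝓞 K), (v.asIdeal : FractionalIdeal (𝓞 K)⁰ K) ^ n v with h𝔟def
  have h𝔟0 : 𝔟 ≠ 0 := by
    rw [h𝔟def]
    refine finprod_induction (fun I : FractionalIdeal (𝓞 K)⁰ K => I ≠ 0) one_ne_zero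
      (fun I J hI hJ => mul_ne_zero hI hJ) fun v => ?_
    exact zpow_ne_zero _ (FractionalIdeal.coeIdeal_ne_zero.mpr v.ne_bot)
  have hcount : ∀ v : HeightOneSpectrum (𝓞 K), FractionalIdeal.count K v 𝔟 = n v := fun v =>
    FractionalIdeal.count_finprod K v n hn_fin
  have hprinc : ((((Units.mk0 𝔟 h𝔟0) ^ h : (FractionalIdeal (𝓞 K)⁰ K)ˣ) :
      FractionalIdeal (𝓞 K)⁰ K) : Submodule (𝓞 K) K).IsPrincipal := by
    rw [← ClassGroup.mk_eq_one_iff, map_pow, hh, pow_card_eq_one]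
  obtain ⟨c, hc⟩ := (FractionalIdeal.isPrincipal_iff _).mp hprinc
  rw [Units.val_pow_eq_pow_val, Units.val_mk0] at hc
  -- `hc : 𝔟 ^ h = spanSingleton c`
  have hc0 : c ≠ 0 := by
    intro h0
    rw [h0, FractionalIdeal.spanSingleton_zero] at hc
    exact pow_ne_zero _ h𝔟0 hc
  have hlogc : ∀ v : HeightOneSpectrum (𝓞 K), log (v.valuation K c) = -(h * n v) := by
    intro v
    have h1 := FractionalIdeal.count_spanSingleton_eq_neg_log_valuation (R := 𝓞 K) v (Units.mk0 c hc0)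
    rw [Units.val_mk0, ← hc, FractionalIdeal.count_pow, hcount v] at h1
    linarith
  refine ⟨c, hc0, fun w hwS => ?_⟩
  -- a reference place `w_v` above `v = w ∩ K`
  set v : HeightOneSpectrum (𝓞 K) := w.under (𝓞 K) with hvdef
  have hex : ∃ w' : HeightOneSpectrum (𝓞 L), w'.under (𝓞 K) = v := ⟨w, rfl⟩
  have hnv : n v = log ((Classical.choose hex).valuation L b) := by simp only [n, dif_pos hex]
  set w₀ := Classical.choose hex with hw₀def
  have hw₀ : w₀.under (𝓞 K) = v := Classical.choose_spec hex
  -- `e(w | v) = 1`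
  haveI : w.asIdeal.LiesOver v.asIdeal := ⟨rfl⟩
  have he : v.asIdeal.ramificationIdx' w.asIdeal = 1 := by
    haveI := v.isPrime
    rw [Ideal.ramificationIdx'_eq_ramificationIdx v.asIdeal w.asIdeal v.ne_bot]
    exact (hunr v hwS).ramificationIdx_eq_one inferInstance
  -- valuation bookkeeping
  have hbw0 : w.valuation L b ≠ 0 := (Valuation.ne_zero_iff _).2 hb
  have hcw : w.valuation L (algebraMap K L c) = v.valuation K c := by
    rw [← HeightOneSpectrum.valuation_liesOver L v w c, he, pow_one]
  have hcw0 : w.valuation L (algebraMap K L c) ≠ 0 :=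
    (Valuation.ne_zero_iff _).2 ((map_ne_zero _).2 hc0)
  obtain ⟨t, ht⟩ := dvd_log_valuation_sub_of_under_eq hN hb hγ (w := w) (w' := w₀) (hw₀ ▸ rfl)
  refine ⟨t, ?_⟩
  rw [map_mul, map_pow, log_mul (pow_ne_zero _ hbw0) hcw0, log_pow, hcw, hlogc v, hnv]
  push_cast
  linear_combination (h : ℤ) * ht

end Descent

end Literature.NumberTheory.GaloisRepresentations

end
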